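import Summits.CriticalPhenomena.PercolationContinuityZ3.Theorems.PercNearOneGluingNoHeavyLowerTailSunflowerKDecreasing
import HarnessLib

/-!
# `NoHeavyLowerTail` (crux stmt-CriticalPhenomena-4575), abstract sunflower cubic: the TWO-COORDINATE MERGING STEP for general
# antitone functions that are supermodular in the merged pair

Support file (seat `prim-ineq-prove-1` gen 34; `--supports stmt-CriticalPhenomena-4575`).  No `sorry`, no named facts.  Memo:
run/shared/lean/prim/prim-ineq-prove-1/FINDING-PRINCIPALCORE-prove1-g34.md §4 STEP 2 and §9 (merging remark).

`KDecreasing.prod_Ex_le_max_merge` (the heart of the K-decreasing-functions lemma) merges two coordinates `e ≠ e'` of the cube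
`Finset g` — `(p e, p e') ↦ (p e · p e', 1)` or `(1, p e · p e')` — without decreasing `∏_i Ex p (F i)`, for the min-type functions
`F i = fmin R (r i)`.  Its proof uses only three properties of each `F i`: antitone under insertion, `≥ 1`, and SUPERMODULAR IN THE PAIR
`(e, e')` (`F(T ∪ e) + F(T ∪ e') ≤ F(T) + F(T ∪ e ∪ e')`).  This file records the step in that generality:
* `condSum_supermod_pair` — the pairwise form of `KDecreasing.condSum_supermod`;
* **`prod_Ex_le_max_merge_of_supermod`** — the merging inequality for arbitrary such `F i`.
USE (memo §9, class S″): the min-type functions of a READ-ONCE core are supermodular in every pair of sibling leaves of an AND gate (no minimal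
transversal contains both), so graded safety of `⋀_k D_k` for DNFs `D_k` with multi-variable terms reduces, merge by merge, to the
disjoint-clause CNF case `…SunflowerGradedSafeCNF` — e.g. `GS((x₁x₂ ∨ x₃)x₄) ⟸ GS((x₁ ∨ x₃)x₄), GS((x₂ ∨ x₃)x₄)`.
-/

noncomputable section

namespace Summit.CriticalPhenomena.PercolationContinuityZ3.Theorems.SunflowerPartition

namespace KDecreasing

open Finset Real

variable {g : Type*} [Fintype g] [DecidableEq g]

/-- Pairwise form of `condSum_supermod`: supermodularity of `F` in the pair `(e, e')` alone gives
`A₀₁ + A₁₀ ≤ A₀₀ + A₁₁` for the conditional sums. [this work] -/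
theorem condSum_supermod_pair {p : g → ℝ} {e e' : g} (hp : ∀ x, 0 ≤ p x ∧ p x ≤ 1) {F : Finset g → ℝ}
    (hF : ∀ T : Finset g, F (insert e T) + F (insert e' T) ≤ F T + F (insert e (insert e' T))) :
    condSum p e e' F false true + condSum p e e' F true false ≤ condSum p e e' F false false + condSum p e e' F true true := by
  unfold condSum
  rw [← Finset.sum_add_distrib, ← Finset.sum_add_distrib]
  refine Finset.sum_le_sum fun T _ => ?_
  simp only [addIf_true, addIf_false]
  rw [← mul_add, ← mul_add]
  refine mul_le_mul_of_nonneg_left ?_ (wrest_nonneg p e e' hp T)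
  linarith [hF T]

variable {ι : Type*} (s : Finset ι)

/-- **Merging two coordinates, general form.**  For `e ≠ e'` with `0 < p e < 1`, `0 < p e'` and functions `F i ≥ 1` that are antitone
under insertion and supermodular in the pair `(e, e')`, the product `∏_i Ex p (F i)` is bounded by its value after replacing `(p e, p e')`
by `(p e · p e', 1)` or by `(1, p e · p e')`.  (On the hyperbola `p e · p e' = const` each factor is a posynomial `c + a x + b·ρ/x`,
`a, b ≥ 0` by antitonicity, `c > 0` by supermodularity; `prod_posy_le_max`.) [this work] -/
theorem prod_Ex_le_max_merge_of_supermod {p : g → ℝ} (hp : ∀ x, 0 ≤ p x ∧ p x ≤ 1) {e e' : g} (hne : e ≠ e') (he0 : 0 < p e)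
    (he1 : p e < 1) (he'0 : 0 < p e') (F : ι → Finset g → ℝ) (hanti : ∀ i ∈ s, ∀ (x : g) (T : Finset g), F i (insert x T) ≤ F i T)
    (hsm : ∀ i ∈ s, ∀ T : Finset g, F i (insert e T) + F i (insert e' T) ≤ F i T + F i (insert e (insert e' T)))
    (h1 : ∀ i ∈ s, ∀ S, 1 ≤ F i S) :
    ∏ i ∈ s, Ex p (F i) ≤
      max (∏ i ∈ s, Ex (Function.update (Function.update p e (p e * p e')) e' 1) (F i))
          (∏ i ∈ s, Ex (Function.update (Function.update p e 1) e' (p e * p e')) (F i)) := by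
  set ρ := p e * p e' with hπ
  have hπ0 : 0 < ρ := mul_pos he0 he'0
  have hπ1 : ρ < 1 := by
    calc ρ = p e * p e' := rfl
      _ ≤ p e * 1 := mul_le_mul_of_nonneg_left (hp e').2 he0.le
      _ < 1 := by linarith
  have hπx : ρ ≤ p e := by
    calc ρ = p e * p e' := rfl
      _ ≤ p e * 1 := mul_le_mul_of_nonneg_left (hp e').2 he0.le
      _ = p e := mul_one _
  -- the one-parameter family along the hyperbola
  let q : ℝ → g → ℝ := fun x => Function.update (Function.update p e x) e' (ρ / x)
  have hqe : ∀ x, q x e = x := fun x => by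
    simp only [q, Function.update_of_ne hne, Function.update_self]
  have hqe' : ∀ x, q x e' = ρ / x := fun x => by simp only [q, Function.update_self]
  have hq0 : q (p e) = p := by
    funext z
    by_cases hz' : z = e'
    · subst hz'; rw [hqe']; rw [hπ]; field_simp
    · by_cases hz : z = e
      · subst hz; exact hqe _
      · simp only [q, Function.update_of_ne hz', Function.update_of_ne hz]
  have hqπ : q ρ = Function.update (Function.update p e (p e * p e')) e' 1 := by
    show Function.update (Function.update p e ρ) e' (ρ / ρ) = _
    rw [div_self hπ0.ne']
  have hq1 : q 1 = Function.update (Function.update p e 1) e' (p e * p e') := by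
    show Function.update (Function.update p e 1) e' (ρ / 1) = _
    rw [div_one]
  -- coefficients
  let A : ι → Bool → Bool → ℝ := fun i se se' => condSum p e e' (F i) se se'
  let c : ι → ℝ := fun i => ρ * (A i false false - A i false true - A i true false + A i true true) + A i true true
  let a : ι → ℝ := fun i => A i false true - A i true true
  let b : ι → ℝ := fun i => A i true false - A i true true
  have hΓ : ∀ x, 0 < x → ∀ i ∈ s, Ex (q x) (F i) = c i + a i * x + b i * (ρ / x) := by
    intro x hx i _
    rw [Ex_expand hne, hqe, hqe']
    simp only [q, condSum_update, c, a, b, A]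
    field_simp
    ring
  have ha : ∀ i ∈ s, 0 ≤ a i := fun i hi =>
    sub_nonneg.2 (condSum_anti (e := e) (e' := e') hp (hanti i hi) true).2
  have hb : ∀ i ∈ s, 0 ≤ b i := fun i hi =>
    sub_nonneg.2 (condSum_anti (e := e) (e' := e') hp (hanti i hi) true).1
  have hc : ∀ i ∈ s, 0 < c i := by
    intro i hi
    have hsm' := condSum_supermod_pair (e := e) (e' := e') hp (hsm i hi)
    have h11 := one_le_condSum (e := e) (e' := e') hp (h1 i hi) true true
    show 0 < ρ * (A i false false - A i false true - A i true false + A i true true) + A i true true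
    have : 0 ≤ A i false false - A i false true - A i true false + A i true true := by
      show 0 ≤ condSum p e e' _ false false - condSum p e e' _ false true - condSum p e e' _ true false +
        condSum p e e' _ true true
      linarith
    have : (1 : ℝ) ≤ A i true true := h11
    positivity
  -- assemble
  have lhs : ∏ i ∈ s, Ex p (F i) = ∏ i ∈ s, (c i + a i * p e + b i * (ρ / p e)) := by
    conv_lhs => rw [← hq0]
    exact Finset.prod_congr rfl (hΓ (p e) he0)
  have r1 : ∏ i ∈ s, Ex (q ρ) (F i) = ∏ i ∈ s, (c i + a i * ρ + b i) := by
    refine Finset.prod_congr rfl fun i hi => ?_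
    rw [hΓ ρ hπ0 i hi, div_self hπ0.ne', mul_one]
  have r2 : ∏ i ∈ s, Ex (q 1) (F i) = ∏ i ∈ s, (c i + a i + b i * ρ) := by
    refine Finset.prod_congr rfl fun i hi => ?_
    rw [hΓ 1 one_pos i hi, mul_one, div_one]
  rw [lhs, ← hqπ, ← hq1, r1, r2]
  exact prod_posy_le_max s c a b hc ha hb hπ0 hπ1 hπx (hp e).2

end KDecreasing

end Summit.CriticalPhenomena.PercolationContinuityZ3.Theorems.SunflowerPartition
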